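import Summits.QuantumFields.BalabanUV.Beta.EriceRemainderEnclosureHistoryAutonomyThreshold

/-!
# EriceRemainderEnclosureHistoryAutonomyThresholdWitness — (E38c) THE EXACT CONSTANT OF THE AUTONOMY THRESHOLD, UPPER SIDE `3√3`: a MARKOV
# tent family at `bγ² = 2` (γ = 1, b = 2, pin 1) with TWO box solutions at EVERY ratio `M·γ∕b > 3√3` — so, with (E38a)
# `…HistoryAutonomyThreshold` (`h ≠ h′ ⟹ 3√3·b < M·γ`), the set of ratios `M·γ∕b` of the non-unique instances of the flow with memory
# (zeroth moment `M`, floor `b`, box ]0,γ], one pin) IS EXACTLY `]3√3, ∞[`, for genuine memory AND for the Markov sub-class: the threshold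
# constant of the AUTONOMY row is `τ* = 3√3 ≈ 5.196`, NOT attained; (E37g)∕(E37h)'s `[5∕2, 10]` and (E37i)'s Markov `≥ 3√3` were brackets of it

Cell `pub-balaban`, β-function sub-cell, BINDER row D4 «RemainderConst leaves for Bałaban's split» (`HOME/BINDER-OWNERS.md`; owner
lineage `b2b-balaban-beta-an4`; this file by co-owner #2 lineage `b2b-balaban-beta-d4-p2`, generation 40), β-FLOW TEAM duty (1),
FREEZE (0) honoured (def-free: the witness family is written as explicit lambdas in every statement, no declaration, no notation;
node U2's `MemFlow`, `SeqBox`, `Sharpness.hSlow` ∕ `ySlow` BY NAME).  Companion of (E38a) (imported) and (E38b) `…HistoryAutonomyThresholdWellPosed`; node U2's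
`T4BetaFlowWellPosed` §7 bump (`tent` of slope 20 centred at `1∕2`, ratio `10`) is the member «second solution through the PEAK far inside
the sub-box»; here the peak slides to the edge `1∕√3 = (1∕γ² + b)^{−1∕2}` of the sub-box, where `|(1∕x²)′| = 2·3^{3∕2}` is smallest.

HONEST FRAMING (page 1, verbatim and binding).  *"Discharging BetaPertH makes Bałaban's UV stability UNCONDITIONAL — a real
constructive-QFT result; it is NOT the continuum limit and NOT the Clay problem."*  THIS FILE DISCHARGES NOTHING OF THE KIND.  A kernel TOY
family of Markov functionals on ]0,1] and elementary real analysis; whether Bałaban's limit functional is Markov (Erice's β_n(g²) is, [I]'s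
(1.22) is not — p. 298) and which constants it has is NOT asserted.  Row D4 class UNCHANGED (critical-path width 0; instance 0∕1; D4
DISCHARGE NO DATE).  HONEST DEPENDENCY: continuum YM on T⁴ ⇐ BetaPertH ∧ nine spine estimates (0/9 proved); BetaPertH ⇐ (D1) ∧ (D4) ∧
CAP+tail; G-an2-4 gates asym, D1 and NE2/3/4.

THE WITNESS.  `γ = 1`, `b = 2`, pin `gIR = 1`, parameter `y ∈ [9∕10, 1[`; the Markov functional `u ↦ φ_y(u 0)`,
`φ_y(x) = 2 + max(3∕y² − 3 − 3(1+y)∕y²·|√3·x − y|, 0)`: floor `2`, a tent of height `3∕y² − 3` centred at `y∕√3` with support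
`[(2y−1)∕√3, 1∕√3]`, Lipschitz constant `L_y = 3√3(1+y)∕y²` (its zeroth moment).  Node U2's `hSlow m = (1+2m)^{−1∕2}` solves the flow (the
tent vanishes at `hSlow 1 = 1∕√3`, its right edge, and at `hSlow m ≤ 1∕√5 ≤ (2y−1)∕√3` for `m ≥ 2`); so does
`hF_y m = (1 + 2m + (3∕y² − 3)·min(m,1))^{−1∕2}` (`hF_y 1 = y∕√3` is the tent's PEAK: `3∕y² = 1 + φ_y(y∕√3)`; later values `≤ 1∕√5` lie left
of the support); `hSlow 1 ≠ hF_y 1`.  Ratio `L_y·γ∕b = 3√3·(1+y)∕(2y²) ↓ 3√3` as `y ↑ 1`: for `τ > 3√3` take `y = max(9∕10, 1 − (κ−1)∕6)`,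
`κ = τ∕(3√3)`.  Inflating the displayed moment `M ≥ L_y` realises every ratio above `3√3` exactly.

WHAT IS PROVED ([folklore]; 0 `def`, 0 sorry; `φ_y` and `hF_y` below stand for the displayed lambdas).  §1 the tent: `tent_eq_zero_of_le`, `tent_eq_zero_of_eq_one`,
`tent_eq_of_eq`, `abs_tent_sub_tent_le`, `sqrt3_div_sqrt_le`, `three_le_three_div_sq`.  §2 the two solutions: `two_le_tentφ`, `abs_tentφ_sub_le`,
`zerothMoment_tentφ`, `one_div_hSlow_sq`, `sqrt3_mul_hSlow_one`, `sqrt3_mul_hSlow_le`, **`memFlow_hSlow_tentφ`**, `hF_zero`, `hF_succ`,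
`seqBox_hF`, **`memFlow_hF_tentφ`**, **`hSlow_ne_hF`**.  §3 ENDs: `ratio_lt_of_gt` (the parameter choice), **`exists_two_markov_solutions_of_gt`**,
**`exists_two_solutions_of_gt`**, **`ratioSet_eq_Ioi`** (memory class: `{M·γ∕b : non-unique} = Set.Ioi (3√3)`), **`markovRatioSet_eq_Ioi`**,
`isGLB_ratioSet`, `not_mem_ratioSet`.
-/

noncomputable section
open Filter Topology Finset

namespace Summit.QuantumFields.BalabanUV.Beta.EriceRemainderEnclosureHistoryAutonomyThresholdWitness

open Literature.MathematicalPhysics.QuantumFieldTheory.Balaban1983to89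
open Literature.MathematicalPhysics.QuantumFieldTheory.Balaban1983to89.T4BetaStationary
open Literature.MathematicalPhysics.QuantumFieldTheory.Balaban1983to89.T4BetaFlowWellPosed
open Literature.MathematicalPhysics.QuantumFieldTheory.Balaban1983to89.T4BetaFlowWellPosed.Sharpness
  (hSlow ySlow hSlow_zero seqBox_hSlow ySlow_pos one_div_one_div_sqrt_sq one_div_sqrt_pos one_div_sqrt_le_one)
open Summit.QuantumFields.BalabanUV.Beta.EriceRemainderEnclosureHistoryAutonomyThreshold

variable {y : ℝ}

/-! ## §1 The tent of height `3∕y² − 3` centred at `y∕√3` in the scaled variable `√3·x` -/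

/-- LEFT OF THE SUPPORT: for `0 < y` and `√3·x ≤ 2y − 1` the tent vanishes. [folklore] -/
theorem tent_eq_zero_of_le (hy0 : 0 < y) {x : ℝ} (hx : Real.sqrt 3 * x ≤ 2 * y - 1) :
    max (3 / y ^ 2 - 3 - 3 * (1 + y) / y ^ 2 * |Real.sqrt 3 * x - y|) 0 = 0 := by
  refine max_eq_right ?_
  have h1 : 1 - y ≤ |Real.sqrt 3 * x - y| := by
    rw [abs_sub_comm]; exact (by linarith : 1 - y ≤ y - Real.sqrt 3 * x).trans (le_abs_self _)
  have hK : 0 ≤ 3 * (1 + y) / y ^ 2 := by positivity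
  have h2 := mul_le_mul_of_nonneg_left h1 hK
  have e : 3 * (1 + y) / y ^ 2 * (1 - y) = 3 / y ^ 2 - 3 := by
    field_simp
    ring
  linarith

/-- AT THE RIGHT EDGE `√3·x = 1` the tent vanishes (exactly: height `3∕y² − 3 = 3(1+y)∕y²·(1 − y)`). [folklore] -/
theorem tent_eq_zero_of_eq_one (hy0 : 0 < y) (hy1 : y ≤ 1) {x : ℝ} (hx : Real.sqrt 3 * x = 1) :
    max (3 / y ^ 2 - 3 - 3 * (1 + y) / y ^ 2 * |Real.sqrt 3 * x - y|) 0 = 0 := by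
  rw [hx, abs_of_nonneg (by linarith : (0 : ℝ) ≤ 1 - y)]
  have e : 3 / y ^ 2 - 3 - 3 * (1 + y) / y ^ 2 * (1 - y) = 0 := by
    field_simp
    ring
  rw [e, max_self]

/-- AT THE CENTRE `√3·x = y` the tent has height `3∕y² − 3 ≥ 0`. [folklore] -/
theorem tent_eq_of_eq (hy0 : 0 < y) (hy1 : y ≤ 1) {x : ℝ} (hx : Real.sqrt 3 * x = y) :
    max (3 / y ^ 2 - 3 - 3 * (1 + y) / y ^ 2 * |Real.sqrt 3 * x - y|) 0 = 3 / y ^ 2 - 3 := by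
  rw [hx, sub_self, abs_zero, mul_zero, sub_zero]
  refine max_eq_left ?_
  have : y ^ 2 ≤ 1 := by nlinarith
  rw [sub_nonneg, le_div_iff₀ (by positivity)]
  linarith

/-- `3 ≤ 3∕y²` for `0 < y ≤ 1`. [folklore] -/
theorem three_le_three_div_sq (hy0 : 0 < y) (hy1 : y ≤ 1) : 3 ≤ 3 / y ^ 2 := by
  have : y ^ 2 ≤ 1 := by nlinarith
  rw [le_div_iff₀ (by positivity)]
  nlinarith

/-- THE TENT IS `3√3(1+y)∕y²`-LIPSCHITZ on ℝ. [folklore] -/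
theorem abs_tent_sub_tent_le (hy0 : 0 < y) (x x' : ℝ) :
    |max (3 / y ^ 2 - 3 - 3 * (1 + y) / y ^ 2 * |Real.sqrt 3 * x - y|) 0
        - max (3 / y ^ 2 - 3 - 3 * (1 + y) / y ^ 2 * |Real.sqrt 3 * x' - y|) 0|
      ≤ 3 * Real.sqrt 3 * (1 + y) / y ^ 2 * |x - x'| := by
  refine (abs_max_sub_max_le_abs _ _ _).trans ?_
  have hK : 0 ≤ 3 * (1 + y) / y ^ 2 := by positivity
  rw [show 3 / y ^ 2 - 3 - 3 * (1 + y) / y ^ 2 * |Real.sqrt 3 * x - y|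
        - (3 / y ^ 2 - 3 - 3 * (1 + y) / y ^ 2 * |Real.sqrt 3 * x' - y|)
      = -(3 * (1 + y) / y ^ 2 * (|Real.sqrt 3 * x - y| - |Real.sqrt 3 * x' - y|)) by ring,
    abs_neg, abs_mul, abs_of_nonneg hK]
  have h1 : |(|Real.sqrt 3 * x - y| - |Real.sqrt 3 * x' - y|)| ≤ Real.sqrt 3 * |x - x'| := by
    refine (abs_abs_sub_abs_le_abs_sub _ _).trans ?_
    rw [show Real.sqrt 3 * x - y - (Real.sqrt 3 * x' - y) = Real.sqrt 3 * (x - x') by ring, abs_mul,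
      abs_of_nonneg (Real.sqrt_nonneg 3)]
  calc 3 * (1 + y) / y ^ 2 * |(|Real.sqrt 3 * x - y| - |Real.sqrt 3 * x' - y|)|
      ≤ 3 * (1 + y) / y ^ 2 * (Real.sqrt 3 * |x - x'|) := mul_le_mul_of_nonneg_left h1 hK
    _ = 3 * Real.sqrt 3 * (1 + y) / y ^ 2 * |x - x'| := by ring

/-- THE SCALED HEIGHT of the later solution values: `w ≥ 5`, `y ≥ 9∕10` ⟹ `√3·(1∕√w) ≤ 2y − 1` (`3∕5 ≤ (4∕5)²`). [folklore] -/
theorem sqrt3_div_sqrt_le {w : ℝ} (hw : 5 ≤ w) (hy : 9 / 10 ≤ y) : Real.sqrt 3 * (1 / Real.sqrt w) ≤ 2 * y - 1 := by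
  have hw0 : 0 < w := by linarith
  rw [mul_one_div, ← Real.sqrt_div' 3 hw0.le, Real.sqrt_le_iff]
  refine ⟨by linarith, ?_⟩
  calc 3 / w ≤ 3 / 5 := div_le_div_of_nonneg_left (by norm_num) (by norm_num) hw
    _ ≤ (2 * y - 1) ^ 2 := by nlinarith

/-! ## §2 The Markov tent family at `bγ² = 2` and its two box solutions -/

/-- Floor `2`. [folklore] -/
theorem two_le_tentφ (y x : ℝ) : 2 ≤ (fun x : ℝ => (2 : ℝ) + max (3 / y ^ 2 - 3 - 3 * (1 + y) / y ^ 2 * |Real.sqrt 3 * x - y|) 0) x := by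
  show (2 : ℝ) ≤ 2 + max _ 0
  exact le_add_of_nonneg_right (le_max_right _ _)

/-- Lipschitz constant `L_y = 3√3(1+y)∕y²` on ℝ (a fortiori on ]0,1]). [folklore] -/
theorem abs_tentφ_sub_le (hy0 : 0 < y) (x x' : ℝ) :
    |(fun x : ℝ => (2 : ℝ) + max (3 / y ^ 2 - 3 - 3 * (1 + y) / y ^ 2 * |Real.sqrt 3 * x - y|) 0) x - 
        (fun x : ℝ => (2 : ℝ) + max (3 / y ^ 2 - 3 - 3 * (1 + y) / y ^ 2 * |Real.sqrt 3 * x - y|) 0) x'| ≤ 3 * Real.sqrt 3 * (1 + y) / y ^ 2 * |x - x'| := by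
  show |2 + max _ 0 - (2 + max _ 0)| ≤ _
  rw [add_sub_add_left_eq_sub]
  exact abs_tent_sub_tent_le hy0 x x'

/-- ZEROTH MOMENT `L_y` of the Markov functional `u ↦ φ_y (u 0)` on every box (the shape of (E37b)∕(E38a)'s `hB`). [folklore] -/
theorem zerothMoment_tentφ (hy0 : 0 < y) (γ : ℝ) :
    ∀ u u' : ℕ → ℝ, SeqBox γ u → SeqBox γ u' → ∀ D : ℝ, (∀ j, |u j - u' j| ≤ D) →
      |(fun x : ℝ => (2 : ℝ) + max (3 / y ^ 2 - 3 - 3 * (1 + y) / y ^ 2 * |Real.sqrt 3 * x - y|) 0) (u 0) - 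
          (fun x : ℝ => (2 : ℝ) + max (3 / y ^ 2 - 3 - 3 * (1 + y) / y ^ 2 * |Real.sqrt 3 * x - y|) 0) (u' 0)| ≤ 3 * Real.sqrt 3 * (1 + y) / y ^ 2 * D :=
  fun u u' _ _ D hD => (abs_tentφ_sub_le hy0 (u 0) (u' 0)).trans (mul_le_mul_of_nonneg_left (hD 0) (by positivity))

/-- Node U2's slow branch: `1∕hSlow m² = 1 + 2m`. [folklore] -/
theorem one_div_hSlow_sq (m : ℕ) : 1 / hSlow m ^ 2 = 1 + 2 * (m : ℝ) := by
  show 1 / (1 / Real.sqrt (ySlow m)) ^ 2 = _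
  rw [one_div_one_div_sqrt_sq (ySlow_pos m).le]
  rfl

/-- `√3·hSlow 1 = 1`: the first slow value sits at the tent's right edge. [folklore] -/
theorem sqrt3_mul_hSlow_one : Real.sqrt 3 * hSlow 1 = 1 := by
  show Real.sqrt 3 * (1 / Real.sqrt (ySlow 1)) = 1
  have : ySlow 1 = 3 := by norm_num [ySlow]
  rw [this, mul_one_div, div_self (Real.sqrt_ne_zero'.2 (by norm_num))]

/-- `√3·hSlow (m+2) ≤ 2y − 1` for `y ≥ 9∕10`: the later slow values lie left of the support. [folklore] -/
theorem sqrt3_mul_hSlow_le (hy : 9 / 10 ≤ y) (m : ℕ) : Real.sqrt 3 * hSlow (m + 2) ≤ 2 * y - 1 := by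
  show Real.sqrt 3 * (1 / Real.sqrt (ySlow (m + 2))) ≤ _
  refine sqrt3_div_sqrt_le ?_ hy
  show (5 : ℝ) ≤ 1 + 2 * ((m + 2 : ℕ) : ℝ)
  push_cast
  linarith [(Nat.cast_nonneg m : (0 : ℝ) ≤ m)]

/-- **THE SLOW BRANCH SOLVES THE TENT FLOW** from the pin `1` (`9∕10 ≤ y ≤ 1`). [folklore] -/
theorem memFlow_hSlow_tentφ (hy0 : 0 < y) (hy9 : 9 / 10 ≤ y) (hy1 : y ≤ 1) :
    MemFlow (fun u => (fun x : ℝ => (2 : ℝ) + max (3 / y ^ 2 - 3 - 3 * (1 + y) / y ^ 2 * |Real.sqrt 3 * x - y|) 0) (u 0)) 1 hSlow := by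
  refine ⟨hSlow_zero, fun m => ?_⟩
  show 1 / hSlow (m + 1) ^ 2 = 1 / hSlow m ^ 2
    + (2 + max (3 / y ^ 2 - 3 - 3 * (1 + y) / y ^ 2 * |Real.sqrt 3 * hSlow (m + 1 + 0) - y|) 0)
  rw [Nat.add_zero, one_div_hSlow_sq, one_div_hSlow_sq]
  have htent : max (3 / y ^ 2 - 3 - 3 * (1 + y) / y ^ 2 * |Real.sqrt 3 * hSlow (m + 1) - y|) 0 = 0 := by
    cases m with
    | zero => exact tent_eq_zero_of_eq_one hy0 hy1 sqrt3_mul_hSlow_one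
    | succ k => exact tent_eq_zero_of_le hy0 (sqrt3_mul_hSlow_le hy9 k)
  rw [htent]
  push_cast
  ring

/-- The fast branch starts at the pin: `hF_y 0 = 1`. [folklore] -/
theorem hF_zero (y : ℝ) : (fun m : ℕ => (1 : ℝ) / Real.sqrt (1 + 2 * (m : ℝ) + (3 / y ^ 2 - 3) * min (m : ℝ) 1)) 0 = 1 := by
  show (1 : ℝ) / Real.sqrt (1 + 2 * ((0 : ℕ) : ℝ) + (3 / y ^ 2 - 3) * min ((0 : ℕ) : ℝ) 1) = 1
  simp

/-- The fast branch from scale `1` on: `hF_y (m+1) = 1∕√(3∕y² + 2m)`. [folklore] -/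
theorem hF_succ (y : ℝ) (m : ℕ) :
    (fun m : ℕ => (1 : ℝ) / Real.sqrt (1 + 2 * (m : ℝ) + (3 / y ^ 2 - 3) * min (m : ℝ) 1)) (m + 1)
      = 1 / Real.sqrt (3 / y ^ 2 + 2 * (m : ℝ)) := by
  show (1 : ℝ) / Real.sqrt (1 + 2 * ((m + 1 : ℕ) : ℝ) + (3 / y ^ 2 - 3) * min ((m + 1 : ℕ) : ℝ) 1) = _
  push_cast
  rw [min_eq_right (by linarith [(Nat.cast_nonneg m : (0 : ℝ) ≤ m)] : (1 : ℝ) ≤ (m : ℝ) + 1)]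
  ring_nf

/-- The radicand from scale `1` on is at least `3`. [folklore] -/
theorem three_le_radicand (hy0 : 0 < y) (hy1 : y ≤ 1) (m : ℕ) : 3 ≤ 3 / y ^ 2 + 2 * (m : ℝ) :=
  (three_le_three_div_sq hy0 hy1).trans (le_add_of_nonneg_right (by positivity))

/-- THE FAST BRANCH IS BOX-VALUED on ]0,1]. [folklore] -/
theorem seqBox_hF (hy0 : 0 < y) (hy1 : y ≤ 1) : SeqBox 1 (fun m : ℕ => (1 : ℝ) / Real.sqrt (1 + 2 * (m : ℝ) + (3 / y ^ 2 - 3) * min (m : ℝ) 1)) := by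
  intro m
  cases m with
  | zero => rw [hF_zero]; exact ⟨one_pos, le_rfl⟩
  | succ k =>
    rw [hF_succ]
    have h3 := three_le_radicand hy0 hy1 k
    exact ⟨one_div_sqrt_pos (by linarith), one_div_sqrt_le_one (by linarith)⟩

/-- `√3·hF_y 1 = y`: the first fast value is the tent's centre. [folklore] -/
theorem sqrt3_mul_hF_one (hy0 : 0 < y) : Real.sqrt 3 * (fun m : ℕ => (1 : ℝ) / Real.sqrt (1 + 2 * (m : ℝ) + (3 / y ^ 2 - 3) * min (m : ℝ) 1)) (0 + 1) = y := by
  rw [hF_succ, Nat.cast_zero, mul_zero, add_zero, Real.sqrt_div' 3 (sq_nonneg y), Real.sqrt_sq hy0.le]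
  field_simp

/-- `√3·hF_y (m+2) ≤ 2y − 1` for `y ≥ 9∕10`: the later fast values lie left of the support. [folklore] -/
theorem sqrt3_mul_hF_le (hy0 : 0 < y) (hy9 : 9 / 10 ≤ y) (hy1 : y ≤ 1) (m : ℕ) :
    Real.sqrt 3 * (fun m : ℕ => (1 : ℝ) / Real.sqrt (1 + 2 * (m : ℝ) + (3 / y ^ 2 - 3) * min (m : ℝ) 1)) (m + 1 + 1) ≤ 2 * y - 1 := by
  rw [hF_succ]
  refine sqrt3_div_sqrt_le ?_ hy9
  have := three_le_three_div_sq hy0 hy1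
  push_cast
  linarith [(Nat.cast_nonneg m : (0 : ℝ) ≤ m)]

/-- **THE FAST BRANCH SOLVES THE TENT FLOW** from the pin `1` (`9∕10 ≤ y ≤ 1`): through the PEAK at the first step (`3∕y² = 1 + φ_y(y∕√3)`),
below the support afterwards. [folklore] -/
theorem memFlow_hF_tentφ (hy0 : 0 < y) (hy9 : 9 / 10 ≤ y) (hy1 : y ≤ 1) :
    MemFlow (fun u => (fun x : ℝ => (2 : ℝ) + max (3 / y ^ 2 - 3 - 3 * (1 + y) / y ^ 2 * |Real.sqrt 3 * x - y|) 0) (u 0)) 1 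
        (fun m : ℕ => (1 : ℝ) / Real.sqrt (1 + 2 * (m : ℝ) + (3 / y ^ 2 - 3) * min (m : ℝ) 1)) := by
  refine ⟨hF_zero y, fun m => ?_⟩
  show 1 / (fun m : ℕ => (1 : ℝ) / Real.sqrt (1 + 2 * (m : ℝ) + (3 / y ^ 2 - 3) * min (m : ℝ) 1)) (m + 1) ^ 2 = 1 / 
      (fun m : ℕ => (1 : ℝ) / Real.sqrt (1 + 2 * (m : ℝ) + (3 / y ^ 2 - 3) * min (m : ℝ) 1)) m ^ 2
    + (2 + max (3 / y ^ 2 - 3 - 3 * (1 + y) / y ^ 2 * |Real.sqrt 3 * 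
        (fun m : ℕ => (1 : ℝ) / Real.sqrt (1 + 2 * (m : ℝ) + (3 / y ^ 2 - 3) * min (m : ℝ) 1)) (m + 1 + 0) - y|) 0)
  rw [Nat.add_zero]
  have h3 := three_le_three_div_sq hy0 hy1
  cases m with
  | zero =>
    rw [tent_eq_of_eq hy0 hy1 (sqrt3_mul_hF_one hy0), hF_succ, hF_zero,
      one_div_one_div_sqrt_sq (by linarith [three_le_radicand hy0 hy1 0])]
    push_cast
    ring
  | succ k =>
    rw [tent_eq_zero_of_le hy0 (sqrt3_mul_hF_le hy0 hy9 hy1 k), hF_succ, hF_succ,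
      one_div_one_div_sqrt_sq (by linarith [three_le_radicand hy0 hy1 (k + 1)]),
      one_div_one_div_sqrt_sq (by linarith [three_le_radicand hy0 hy1 k])]
    push_cast
    ring

/-- **THE TWO BRANCHES DIFFER** (at scale `1`: `1∕hSlow 1² = 3 ≠ 3∕y² = 1∕hF_y 1²` for `y < 1`). [folklore] -/
theorem hSlow_ne_hF (hy0 : 0 < y) (hy1 : y < 1) : hSlow ≠ (fun m : ℕ => (1 : ℝ) / Real.sqrt (1 + 2 * (m : ℝ) + (3 / y ^ 2 - 3) * min (m : ℝ) 1)) := by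
  intro heq
  have h1 : 1 / hSlow 1 ^ 2 = 1 / (fun m : ℕ => (1 : ℝ) / Real.sqrt (1 + 2 * (m : ℝ) + (3 / y ^ 2 - 3) * min (m : ℝ) 1)) (0 + 1) ^ 2 := by rw [heq]
  rw [one_div_hSlow_sq, hF_succ, one_div_one_div_sqrt_sq (by linarith [three_le_radicand hy0 hy1.le 0])] at h1
  push_cast at h1
  have hy2 : y ^ 2 < 1 := by nlinarith
  have : 3 < 3 / y ^ 2 := by rw [lt_div_iff₀ (by positivity)]; nlinarith
  linarith

/-! ## §3 ENDs: every ratio above `3√3` is realised; the ratio sets are `]3√3, ∞[` -/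

/-- THE PARAMETER CHOICE: for `τ > 3√3` there is `y ∈ [9∕10, 1[` with `L_y·1 < τ·2`, `L_y = 3√3(1+y)∕y²`. [folklore] -/
theorem ratio_lt_of_gt {τ : ℝ} (hτ : 3 * Real.sqrt 3 < τ) :
    ∃ y : ℝ, 9 / 10 ≤ y ∧ y < 1 ∧ 3 * Real.sqrt 3 * (1 + y) / y ^ 2 * 1 < τ * 2 := by
  set κ : ℝ := τ / (3 * Real.sqrt 3) with hκ
  have h33 : 0 < 3 * Real.sqrt 3 := three_sqrt_three_pos
  have hκ1 : 1 < κ := (one_lt_div h33).2 hτ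
  refine ⟨max (9 / 10) (1 - (κ - 1) / 6), le_max_left _ _, max_lt (by norm_num) (by linarith), ?_⟩
  set y : ℝ := max (9 / 10) (1 - (κ - 1) / 6) with hy
  have hy9 : 9 / 10 ≤ y := le_max_left _ _
  have hyκ : 1 - y ≤ (κ - 1) / 6 := by linarith [le_max_right (9 / 10 : ℝ) (1 - (κ - 1) / 6)]
  have hy0 : 0 < y := by linarith
  -- `1 + y < 2κ·y²`
  have key : 1 + y < 2 * κ * y ^ 2 := by
    nlinarith [mul_nonneg (sub_nonneg.2 hκ1.le) (sq_nonneg y), mul_nonneg (sub_nonneg.2 hy9) (sub_nonneg.2 hκ1.le)]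
  have e : τ = 3 * Real.sqrt 3 * κ := by rw [hκ]; field_simp
  rw [e, mul_one, div_lt_iff₀ (by positivity)]
  nlinarith [key, h33]

/-- **EVERY RATIO ABOVE `3√3` CARRIES A NON-UNIQUE MARKOV INSTANCE** — in the binder shapes of (E37i) `memFlow_unique_of_markov_ratio`
(`φ` `L`-Lipschitz with floor `b` on ]0,γ], pin in ]0,γ], two distinct box solutions) with `L·γ < τ·b`: (E37i)'s `3√3` is SHARP. [folklore] -/
theorem exists_two_markov_solutions_of_gt {τ : ℝ} (hτ : 3 * Real.sqrt 3 < τ) :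
    ∃ (φ : ℝ → ℝ) (L γ b gIR : ℝ) (h h' : ℕ → ℝ),
      (∀ x x', 0 < x → x ≤ γ → 0 < x' → x' ≤ γ → |φ x - φ x'| ≤ L * |x - x'|) ∧ 0 ≤ L ∧ 0 < gIR ∧ gIR ≤ γ ∧
      0 < b ∧ (∀ x, 0 < x → x ≤ γ → b ≤ φ x) ∧ SeqBox γ h ∧ SeqBox γ h' ∧
      MemFlow (fun u => φ (u 0)) gIR h ∧ MemFlow (fun u => φ (u 0)) gIR h' ∧ h ≠ h' ∧ L * γ < τ * b := by
  obtain ⟨y, hy9, hy1, hlt⟩ := ratio_lt_of_gt hτ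
  have hy0 : 0 < y := by linarith
  exact ⟨(fun x : ℝ => (2 : ℝ) + max (3 / y ^ 2 - 3 - 3 * (1 + y) / y ^ 2 * |Real.sqrt 3 * x - y|) 0), 3 * Real.sqrt 3 * (1 + y) / y ^ 2, 1, 2, 1, hSlow, 
      (fun m : ℕ => (1 : ℝ) / Real.sqrt (1 + 2 * (m : ℝ) + (3 / y ^ 2 - 3) * min (m : ℝ) 1)),
    fun x x' _ _ _ _ => abs_tentφ_sub_le hy0 x x', by positivity, one_pos, le_rfl, two_pos,
    fun x _ _ => two_le_tentφ y x, seqBox_hSlow, seqBox_hF hy0 hy1.le, memFlow_hSlow_tentφ hy0 hy9 hy1.le,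
    memFlow_hF_tentφ hy0 hy9 hy1.le, hSlow_ne_hF hy0 hy1, hlt⟩

/-- **EVERY RATIO ABOVE `3√3` CARRIES A NON-UNIQUE INSTANCE** — in the binder shapes of (E38a)'s `memFlow_unique_zs_closed` (zeroth moment `M`,
floor `b`, box ]0,γ], one pin) with `M·γ < τ·b`: (E38a)'s `3√3` is SHARP. [folklore] -/
theorem exists_two_solutions_of_gt {τ : ℝ} (hτ : 3 * Real.sqrt 3 < τ) :
    ∃ (B : (ℕ → ℝ) → ℝ) (M γ b gIR : ℝ) (h h' : ℕ → ℝ),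
      (∀ u u' : ℕ → ℝ, SeqBox γ u → SeqBox γ u' → ∀ D : ℝ, (∀ j, |u j - u' j| ≤ D) → |B u - B u'| ≤ M * D) ∧
      0 ≤ M ∧ 0 < gIR ∧ gIR ≤ γ ∧ 0 < b ∧ (∀ u, SeqBox γ u → b ≤ B u) ∧ SeqBox γ h ∧ SeqBox γ h' ∧
      MemFlow B gIR h ∧ MemFlow B gIR h' ∧ h ≠ h' ∧ M * γ < τ * b := by
  obtain ⟨φ, L, γ, b, gIR, h, h', hL, hL0, hgIR, hgIRγ, hb, hlo, hh, hh', hf, hf', hne, hlt⟩ :=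
    exists_two_markov_solutions_of_gt hτ
  refine ⟨fun u => φ (u 0), L, γ, b, gIR, h, h', fun u u' hu hu' D hD => ?_, hL0, hgIR, hgIRγ, hb,
    fun u hu => hlo (u 0) (hu 0).1 (hu 0).2, hh, hh', hf, hf', hne, hlt⟩
  exact (hL (u 0) (u' 0) (hu 0).1 (hu 0).2 (hu' 0).1 (hu' 0).2).trans (mul_le_mul_of_nonneg_left (hD 0) hL0)

/-- **THE THRESHOLD THEOREM (memory class).**  The set of ratios `M·γ∕b` over all non-unique instances of the flow with memory — a functional
with zeroth moment `M ≥ 0` and floor `b > 0` on the box ]0,γ], one pin `gIR ∈ ]0,γ]`, two distinct box solutions — IS EXACTLY `]3√3, ∞[`: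
below by (E38a)'s `ratio_gt_of_two_solutions`, above by the tent family with the displayed moment inflated to `M = r·b∕γ`. [folklore] -/
theorem ratioSet_eq_Ioi :
    {r : ℝ | ∃ (B : (ℕ → ℝ) → ℝ) (M γ b gIR : ℝ) (h h' : ℕ → ℝ),
      (∀ u u' : ℕ → ℝ, SeqBox γ u → SeqBox γ u' → ∀ D : ℝ, (∀ j, |u j - u' j| ≤ D) → |B u - B u'| ≤ M * D) ∧
      0 ≤ M ∧ 0 < gIR ∧ gIR ≤ γ ∧ 0 < b ∧ (∀ u, SeqBox γ u → b ≤ B u) ∧ SeqBox γ h ∧ SeqBox γ h' ∧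
      MemFlow B gIR h ∧ MemFlow B gIR h' ∧ h ≠ h' ∧ r = M * γ / b} = Set.Ioi (3 * Real.sqrt 3) := by
  ext r
  constructor
  · rintro ⟨B, M, γ, b, gIR, h, h', hB, hM, hgIR, hgIRγ, hb, hlo, hh, hh', hf, hf', hne, rfl⟩
    rw [Set.mem_Ioi, lt_div_iff₀ hb]
    exact ratio_gt_of_two_solutions hB hM hgIR hgIRγ hb hlo hh hh' hf hf' hne
  · intro hr
    obtain ⟨B, M, γ, b, gIR, h, h', hB, hM, hgIR, hgIRγ, hb, hlo, hh, hh', hf, hf', hne, hlt⟩ :=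
      exists_two_solutions_of_gt (Set.mem_Ioi.1 hr)
    have hγ : 0 < γ := lt_of_lt_of_le hgIR hgIRγ
    have hMle : M ≤ r * b / γ := by rw [le_div_iff₀ hγ]; exact hlt.le
    refine ⟨B, r * b / γ, γ, b, gIR, h, h', fun u u' hu hu' D hD => ?_, hM.trans hMle, hgIR, hgIRγ, hb, hlo,
      hh, hh', hf, hf', hne, by field_simp⟩
    exact (hB u u' hu hu' D hD).trans (mul_le_mul_of_nonneg_right hMle ((abs_nonneg _).trans (hD 0)))

/-- **THE THRESHOLD THEOREM (Markov sub-class).**  The same set over the MARKOV instances `u ↦ φ (u 0)` (`φ` `L`-Lipschitz with floor `b`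
on ]0,γ], (E37i)'s binder shapes) is ALSO exactly `]3√3, ∞[`: long memory does NOT lower the threshold constant below the Markov one. [folklore] -/
theorem markovRatioSet_eq_Ioi :
    {r : ℝ | ∃ (φ : ℝ → ℝ) (L γ b gIR : ℝ) (h h' : ℕ → ℝ),
      (∀ x x', 0 < x → x ≤ γ → 0 < x' → x' ≤ γ → |φ x - φ x'| ≤ L * |x - x'|) ∧ 0 ≤ L ∧ 0 < gIR ∧ gIR ≤ γ ∧
      0 < b ∧ (∀ x, 0 < x → x ≤ γ → b ≤ φ x) ∧ SeqBox γ h ∧ SeqBox γ h' ∧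
      MemFlow (fun u => φ (u 0)) gIR h ∧ MemFlow (fun u => φ (u 0)) gIR h' ∧ h ≠ h' ∧ r = L * γ / b}
      = Set.Ioi (3 * Real.sqrt 3) := by
  ext r
  constructor
  · rintro ⟨φ, L, γ, b, gIR, h, h', hL, hL0, hgIR, hgIRγ, hb, hlo, hh, hh', hf, hf', hne, rfl⟩
    rw [Set.mem_Ioi, lt_div_iff₀ hb]
    refine ratio_gt_of_two_solutions (B := fun u => φ (u 0)) (fun u u' hu hu' D hD => ?_) hL0 hgIR hgIRγ hb
      (fun u hu => hlo (u 0) (hu 0).1 (hu 0).2) hh hh' hf hf' hne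
    exact (hL (u 0) (u' 0) (hu 0).1 (hu 0).2 (hu' 0).1 (hu' 0).2).trans (mul_le_mul_of_nonneg_left (hD 0) hL0)
  · intro hr
    obtain ⟨φ, L, γ, b, gIR, h, h', hL, hL0, hgIR, hgIRγ, hb, hlo, hh, hh', hf, hf', hne, hlt⟩ :=
      exists_two_markov_solutions_of_gt (Set.mem_Ioi.1 hr)
    have hγ : 0 < γ := lt_of_lt_of_le hgIR hgIRγ
    have hLle : L ≤ r * b / γ := by rw [le_div_iff₀ hγ]; exact hlt.le
    refine ⟨φ, r * b / γ, γ, b, gIR, h, h', fun x x' hx hxγ hx' hx'γ => ?_, hL0.trans hLle, hgIR, hgIRγ, hb, hlo,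
      hh, hh', hf, hf', hne, by field_simp⟩
    exact (hL x x' hx hxγ hx' hx'γ).trans (mul_le_mul_of_nonneg_right hLle (abs_nonneg _))

/-- `3√3` IS THE INFIMUM of the ratio set … [folklore] -/
theorem isGLB_ratioSet :
    IsGLB {r : ℝ | ∃ (B : (ℕ → ℝ) → ℝ) (M γ b gIR : ℝ) (h h' : ℕ → ℝ),
      (∀ u u' : ℕ → ℝ, SeqBox γ u → SeqBox γ u' → ∀ D : ℝ, (∀ j, |u j - u' j| ≤ D) → |B u - B u'| ≤ M * D) ∧
      0 ≤ M ∧ 0 < gIR ∧ gIR ≤ γ ∧ 0 < b ∧ (∀ u, SeqBox γ u → b ≤ B u) ∧ SeqBox γ h ∧ SeqBox γ h' ∧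
      MemFlow B gIR h ∧ MemFlow B gIR h' ∧ h ≠ h' ∧ r = M * γ / b} (3 * Real.sqrt 3) := by
  rw [ratioSet_eq_Ioi]
  exact isGLB_Ioi

/-- … and is NOT ATTAINED: no non-unique instance sits at the ratio `3√3` itself. [folklore] -/
theorem not_mem_ratioSet :
    (3 * Real.sqrt 3) ∉ {r : ℝ | ∃ (B : (ℕ → ℝ) → ℝ) (M γ b gIR : ℝ) (h h' : ℕ → ℝ),
      (∀ u u' : ℕ → ℝ, SeqBox γ u → SeqBox γ u' → ∀ D : ℝ, (∀ j, |u j - u' j| ≤ D) → |B u - B u'| ≤ M * D) ∧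
      0 ≤ M ∧ 0 < gIR ∧ gIR ≤ γ ∧ 0 < b ∧ (∀ u, SeqBox γ u → b ≤ B u) ∧ SeqBox γ h ∧ SeqBox γ h' ∧
      MemFlow B gIR h ∧ MemFlow B gIR h' ∧ h ≠ h' ∧ r = M * γ / b} := by
  rw [ratioSet_eq_Ioi]
  exact lt_irrefl (3 * Real.sqrt 3)

end Summit.QuantumFields.BalabanUV.Beta.EriceRemainderEnclosureHistoryAutonomyThresholdWitness

end
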